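import Summits.QuantumFields.BalabanUV.Beta.EriceFlowEnclosureCesaroTwoThirdsLaw
import Summits.QuantumFields.BalabanUV.Beta.EriceFlowEnclosureCesaroHarmonicAverage

/-!
# Beta / EriceFlowEnclosureHarmonicTwoThirdsLaw — THE TWO-THIRDS LAW FOR THE RG-TIME ∕ CUTOFF (HARMONIC SCALE) AVERAGE: for M differentiable on
# ]0, δ[ with `|M| ≤ C_M`, M K_M-log-Lipschitz and the window modulus `|M′ u − M′ t| ≤ L_M(u − t)∕t²`, the harmonic average
# `H(t) = t·∫ₜᶜ M(s) ds∕s²` (P2 #52f: THE average uniform in RG time ∕ over cutoffs) obeys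
#     **`|H t − m| ≤ A·t^γ on ]0, τ]  ⟹  |M t − m| ≤ (5A + 4L)·t^{2γ∕3}`**,  `L = 2(K_M + 10C_M) + L_M`,
# on an explicit chart — against P2 #52f `harmonic_sqrt_law`'s `4√(CE) + 3E` (exponent γ∕2) for the Cesàro mean of a merely bounded φ.
# THE TRICK: `Φ(t) := t·H(t)` has `Φ(t)∕t = H(t)` (so the H-rate IS a Cesàro-type rate for Φ) and `Φ′ = 2H − M =: ψ`; ψ′ = 2H′ − M′ with
# `H′ = (H − M)∕t` has the window modulus (P2 #56f `cesaro_deriv_windowModulus` applied to Φ∕id = H), so P2 #56f `twoThirds_law` gives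
# `|ψ − m| = O(t^{2γ∕3})`, and `M − m = 2(H − m) − (ψ − m)`.  In ROW L120's CLASS (r∕u² bounded AND K-log-Lipschitz) the three-loop Cesàro mean M
# has all three properties (P2 #52a, P2 #56f §2), so the RG-TIME-AVERAGED letter deviation of rows L127–L130 determines the letter deviation with the
# loss `γ ↦ 2γ∕3`, not the square root (END `harmonic_twoThirds_of_cesaro`).  Pure [folklore]; no Erice sentence occurs.
#   §1 `harmonicIntegral_hasDerivAt` (`(∫ₜᶜ M s⁻²)′ = −M t∕t²`), `harmonic_hasDerivAt` (`H′ = (H − M)∕t`), `tH_hasDerivAt` (`(tH)′ = 2H − M`),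
#      `harmonic_abs_le` (`|H| ≤ C_M` on ]0, c]), `harmonic_logLip` (H is 2C_M-log-Lipschitz);
#   §2 `psi_hasDerivAt`, `Hderiv_windowModulus`, `psi1_windowModulus`;
#   §3 HEADLINE **`harmonic_twoThirds_law`**; END **`harmonic_twoThirds_of_cesaro`** (φ bounded K-log-Lipschitz ⟹ for its Cesàro mean M:
#      H-rate `A t^γ` ⟹ `|M t − m| ≤ (5A + 4(2(2C + 10C) + (K + 4C)))·t^{2γ∕3}`).
# (β-flow team, prover 2 = lower ∕ positivity side, unit `b2b-balaban-beta-bflow-p2`, gen 39; module P2 #56h)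

HONEST FRAMING (page 1 of everything the β sub-cell writes): discharging `BetaPertH` makes Bałaban's UV stability UNCONDITIONAL — a
real constructive-QFT result; it is NOT the continuum limit and NOT the Clay problem.  HONEST DEPENDENCY (cell reorg 2026-08-19,
verbatim): «continuum YM on T⁴ ⇐ BetaPertH ∧ nine spine estimates (0/9 proved); BetaPertH ⇐ (D1) ∧ (D4) ∧ CAP+tail; G-an2-4 gates
asym, D1 and NE2/3/4.»  THIS MODULE DISCHARGES NOTHING and quotes nothing: [folklore] real analysis (shapes: M = the three-loop Cesàro mean, H its
RG-time ∕ cutoff average in the scale variable).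

WHAT THIS FILE PROVES (0 sorry, 0 def): §1 `harmonicIntegral_hasDerivAt`, `harmonic_hasDerivAt`, `tH_hasDerivAt`, `harmonic_abs_le`, `harmonic_logLip`;
§2 `psi_hasDerivAt`, `Hderiv_windowModulus`, `psi1_windowModulus`; §3 HEADLINE **`harmonic_twoThirds_law`**, END **`harmonic_twoThirds_of_cesaro`**.
NOT CLAIMED: sharpness of 2∕3 for the harmonic average (expected, by P2 #56g's witness read through `harmonic_of_cesaro`; not filed); the bare-side
∕ RG-time kernel junctions with rates (rows L119∕L120 by name — routine after P2 #53k∕#52i, not filed); `BetaPertH`; continuum; Clay.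
-/

namespace Summit.QuantumFields.BalabanUV.Beta.EriceFlowEnclosureHarmonicTwoThirdsLaw

open Set Filter Topology MeasureTheory intervalIntegral
open Summit.QuantumFields.BalabanUV.Beta.EriceFlowEnclosureCesaroTauberianRate (logLip_of_deriv_abs_le)
open Summit.QuantumFields.BalabanUV.Beta.EriceFlowEnclosureCesaroHigherOrder
  (const_nonneg cesaro_abs_le cesaro_logLip cesaro_continuousOn)
open Summit.QuantumFields.BalabanUV.Beta.EriceFlowEnclosureCesaroTwoThirdsLaw (twoThirds_law quotient_hasDerivAt cesaro_deriv_windowModulus)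
open Summit.QuantumFields.BalabanUV.Beta.EriceFlowEnclosureCesaroHarmonicAverage (inv_sq_integral)

noncomputable section

variable {M M₁ : ℝ → ℝ} {δ c CM KM LM : ℝ}

/-! ## §1 The harmonic average and its derivative -/

/-- `(∫ₜᶜ M(s) s⁻² ds)′ = −M(t)∕t²` at every `t ∈ ]0, δ[` when M is continuous on ]0, δ[ and `0 < c < δ` (FTC at the lower limit). [folklore] -/
theorem harmonicIntegral_hasDerivAt (hcont : ContinuousOn M (Ioo 0 δ)) (hc0 : 0 < c) (hcδ : c < δ) {t : ℝ} (ht : t ∈ Ioo 0 δ) :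
    HasDerivAt (fun u => ∫ s in u..c, M s / s ^ 2) (-(M t / t ^ 2)) t := by
  have hcont2 : ContinuousOn (fun s => M s / s ^ 2) (Ioo 0 δ) :=
    hcont.div (continuousOn_id.pow 2) fun s hs => pow_ne_zero 2 hs.1.ne'
  have hI : IntervalIntegrable (fun s => M s / s ^ 2) volume t c := by
    refine (hcont2.mono ?_).intervalIntegrable
    intro s hs
    rcases le_total t c with htc | hct
    · rw [uIcc_of_le htc] at hs; exact ⟨ht.1.trans_le hs.1, lt_of_le_of_lt hs.2 hcδ⟩
    · rw [uIcc_of_ge hct] at hs; exact ⟨hc0.trans_le hs.1, lt_of_le_of_lt hs.2 ht.2⟩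
  have hmeas : StronglyMeasurableAtFilter (fun s => M s / s ^ 2) (𝓝 t) volume :=
    hcont2.stronglyMeasurableAtFilter isOpen_Ioo t ht
  have hca : ContinuousAt (fun s => M s / s ^ 2) t := hcont2.continuousAt (Ioo_mem_nhds ht.1 ht.2)
  exact intervalIntegral.integral_hasDerivAt_left hI hmeas hca

/-- **`H′(t) = (H t − M t)∕t`**, `H(t) = t·∫ₜᶜ M s⁻²`. [folklore] -/
theorem harmonic_hasDerivAt (hcont : ContinuousOn M (Ioo 0 δ)) (hc0 : 0 < c) (hcδ : c < δ) {t : ℝ} (ht : t ∈ Ioo 0 δ) :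
    HasDerivAt (fun u => u * ∫ s in u..c, M s / s ^ 2)
      (((t * ∫ s in t..c, M s / s ^ 2) - M t) / t) t := by
  have h := (hasDerivAt_id t).mul (harmonicIntegral_hasDerivAt hcont hc0 hcδ ht)
  refine h.congr_deriv ?_
  have ht0 : t ≠ 0 := ht.1.ne'
  simp only [id]
  field_simp
  ring

/-- **`(t·H t)′ = 2H t − M t`**. [folklore] -/
theorem tH_hasDerivAt (hcont : ContinuousOn M (Ioo 0 δ)) (hc0 : 0 < c) (hcδ : c < δ) {t : ℝ} (ht : t ∈ Ioo 0 δ) :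
    HasDerivAt (fun u => u * (u * ∫ s in u..c, M s / s ^ 2))
      (2 * (t * ∫ s in t..c, M s / s ^ 2) - M t) t := by
  have h := (hasDerivAt_id t).mul (harmonic_hasDerivAt hcont hc0 hcδ ht)
  refine h.congr_deriv ?_
  have ht0 : t ≠ 0 := ht.1.ne'
  simp only [id]
  field_simp
  ring

/-- **`|H t| ≤ C_M`** for `0 < t ≤ c` when `|M| ≤ C_M` on ]0, δ[ (`|∫ₜᶜ M s⁻²| ≤ C_M(t⁻¹ − c⁻¹) ≤ C_M∕t`). [folklore] -/
theorem harmonic_abs_le (hcδ : c < δ) (hb : ∀ s ∈ Ioo 0 δ, |M s| ≤ CM)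
    {t : ℝ} (ht : 0 < t) (htc : t ≤ c) : |t * ∫ s in t..c, M s / s ^ 2| ≤ CM := by
  have hCM : 0 ≤ CM := (abs_nonneg _).trans (hb t ⟨ht, lt_of_le_of_lt htc hcδ⟩)
  have hg : IntervalIntegrable (fun s : ℝ => CM * (s ^ 2)⁻¹) volume t c :=
    (continuousOn_const.mul ((continuousOn_id.pow 2).inv₀ fun s hs => pow_ne_zero 2 (ht.trans_le hs.1).ne')).intervalIntegrable_of_Icc htc
  have hle : ‖∫ s in t..c, M s / s ^ 2‖ ≤ ∫ s in t..c, CM * (s ^ 2)⁻¹ := by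
    refine intervalIntegral.norm_integral_le_of_norm_le htc (Eventually.of_forall fun s hs => ?_) hg
    have hs0 : 0 < s := ht.trans hs.1
    rw [Real.norm_eq_abs, abs_div, abs_of_pos (pow_pos hs0 2), div_eq_mul_inv]
    exact mul_le_mul_of_nonneg_right (hb s ⟨hs0, lt_of_le_of_lt hs.2 hcδ⟩) (inv_nonneg.mpr (pow_pos hs0 2).le)
  rw [intervalIntegral.integral_const_mul, inv_sq_integral ht htc, Real.norm_eq_abs] at hle
  have hc0 : 0 < c := ht.trans_le htc
  rw [abs_mul, abs_of_pos ht]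
  calc t * |∫ s in t..c, M s / s ^ 2| ≤ t * (CM * (t⁻¹ - c⁻¹)) := mul_le_mul_of_nonneg_left hle ht.le
    _ = CM * (1 - t / c) := by field_simp
    _ ≤ CM * 1 := by
        refine mul_le_mul_of_nonneg_left ?_ hCM
        have : 0 ≤ t / c := by positivity
        linarith
    _ = CM := mul_one _

/-- **H is 2C_M-log-Lipschitz on ]0, c[** (`|H′| = |H − M|∕t ≤ 2C_M∕t`, P2 #51a `logLip_of_deriv_abs_le`). [folklore] -/
theorem harmonic_logLip (hcont : ContinuousOn M (Ioo 0 δ)) (hc0 : 0 < c) (hcδ : c < δ) (hb : ∀ s ∈ Ioo 0 δ, |M s| ≤ CM) :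
    ∀ t u : ℝ, 0 < t → t ≤ u → u < c →
      |(u * ∫ s in u..c, M s / s ^ 2) - (t * ∫ s in t..c, M s / s ^ 2)| ≤ (2 * CM) * Real.log (u / t) := by
  refine logLip_of_deriv_abs_le (δ := c) (fun v hv => harmonic_hasDerivAt hcont hc0 hcδ ⟨hv.1, hv.2.trans hcδ⟩) ?_
  intro v hv
  have hH := harmonic_abs_le hcδ hb hv.1 hv.2.le
  have hMv := hb v ⟨hv.1, hv.2.trans hcδ⟩
  rw [abs_div, abs_of_pos hv.1]
  refine div_le_div_of_nonneg_right ?_ hv.1.le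
  exact (abs_sub _ _).trans (by linarith)

/-! ## §2 ψ = 2H − M and the window modulus of its derivative -/

/-- `ψ′ = 2H′ − M′` with `ψ = 2H − M`, `H′ = (H − M)∕t`, `M′ = M₁`. [folklore] -/
theorem psi_hasDerivAt (hM : ∀ t ∈ Ioo 0 δ, HasDerivAt M (M₁ t) t) (hc0 : 0 < c) (hcδ : c < δ) {t : ℝ} (ht : t ∈ Ioo 0 δ) :
    HasDerivAt (fun u => 2 * (u * ∫ s in u..c, M s / s ^ 2) - M u)
      (2 * (((t * ∫ s in t..c, M s / s ^ 2) - M t) / t) - M₁ t) t := by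
  have hcont : ContinuousOn M (Ioo 0 δ) := fun x hx => (hM x hx).continuousAt.continuousWithinAt
  exact ((harmonic_hasDerivAt hcont hc0 hcδ ht).const_mul 2).sub (hM t ht)

/-- **THE WINDOW MODULUS OF H′**: `|M| ≤ C_M`, M K_M-log-Lipschitz (K_M ≥ 0) on ]0, δ[, `0 < c < δ` ⟹ for `0 < t ≤ u < c`:
**`|H′ u − H′ t| ≤ (K_M + 10C_M)(u − t)∕t²`** — P2 #56f `cesaro_deriv_windowModulus` applied to `Φ = t·H` (so `Φ∕id = H`, `Φ′ = 2H − M`: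
`|2H − M| ≤ 3C_M`, (4C_M + K_M)-log-Lipschitz; `|H| ≤ C_M`, 2C_M-log-Lipschitz). [folklore] -/
theorem Hderiv_windowModulus (hcont : ContinuousOn M (Ioo 0 δ)) (hc0 : 0 < c) (hcδ : c < δ)
    (hb : ∀ s ∈ Ioo 0 δ, |M s| ≤ CM) (hKM : 0 ≤ KM)
    (hlipM : ∀ t u : ℝ, 0 < t → t ≤ u → u < δ → |M u - M t| ≤ KM * Real.log (u / t)) :
    ∀ t u : ℝ, 0 < t → t ≤ u → u < c →
      |((u * ∫ s in u..c, M s / s ^ 2) - M u) / u - ((t * ∫ s in t..c, M s / s ^ 2) - M t) / t| ≤ (KM + 10 * CM) * (u - t) / t ^ 2 := by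
  have hCM : 0 ≤ CM := (abs_nonneg _).trans (hb (c / 2) ⟨by positivity, by linarith⟩)
  have hHlip := harmonic_logLip hcont hc0 hcδ hb
  -- ψ = 2H − M: bounded by 3C_M, (4C_M + K_M)-log-Lipschitz on ]0, c[
  have hψb : ∀ t ∈ Ioo 0 c, |2 * (t * ∫ s in t..c, M s / s ^ 2) - M t| ≤ 3 * CM := by
    intro t ht
    have h1 := harmonic_abs_le hcδ hb ht.1 ht.2.le
    have h2 := hb t ⟨ht.1, ht.2.trans hcδ⟩
    calc _ ≤ |2 * (t * ∫ s in t..c, M s / s ^ 2)| + |M t| := abs_sub _ _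
      _ ≤ 2 * CM + CM := by rw [abs_mul, abs_of_pos (by norm_num : (0:ℝ) < 2)]; linarith
      _ = 3 * CM := by ring
  have hψlip : ∀ t u : ℝ, 0 < t → t ≤ u → u < c →
      |(2 * (u * ∫ s in u..c, M s / s ^ 2) - M u) - (2 * (t * ∫ s in t..c, M s / s ^ 2) - M t)| ≤ (4 * CM + KM) * Real.log (u / t) := by
    intro t u ht htu huc
    have h1 := hHlip t u ht htu huc
    have h2 := hlipM t u ht htu (huc.trans hcδ)
    calc _ = |2 * ((u * ∫ s in u..c, M s / s ^ 2) - (t * ∫ s in t..c, M s / s ^ 2)) - (M u - M t)| := by ring_nf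
      _ ≤ |2 * ((u * ∫ s in u..c, M s / s ^ 2) - (t * ∫ s in t..c, M s / s ^ 2))| + |M u - M t| := abs_sub _ _
      _ ≤ 2 * (2 * CM * Real.log (u / t)) + KM * Real.log (u / t) := by
          rw [abs_mul, abs_of_pos (by norm_num : (0:ℝ) < 2)]; linarith
      _ = (4 * CM + KM) * Real.log (u / t) := by ring
  have hHb : ∀ t ∈ Ioo 0 c, |(t * (t * ∫ s in t..c, M s / s ^ 2)) / t| ≤ CM := by
    intro t ht
    rw [mul_div_cancel_left₀ _ ht.1.ne']
    exact harmonic_abs_le hcδ hb ht.1 ht.2.le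
  have hHlip' : ∀ t u : ℝ, 0 < t → t ≤ u → u < c →
      |(u * (u * ∫ s in u..c, M s / s ^ 2)) / u - (t * (t * ∫ s in t..c, M s / s ^ 2)) / t| ≤ (2 * CM) * Real.log (u / t) := by
    intro t u ht htu huc
    rw [mul_div_cancel_left₀ _ (ht.trans_le htu).ne', mul_div_cancel_left₀ _ ht.ne']
    exact hHlip t u ht htu huc
  have h := cesaro_deriv_windowModulus (δ := c) (Φ := fun t => t * (t * ∫ s in t..c, M s / s ^ 2))
    (φ := fun t => 2 * (t * ∫ s in t..c, M s / s ^ 2) - M t) (K := 4 * CM + KM) (KM := 2 * CM) (C := 3 * CM) (CM := CM)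
    (by positivity) (by positivity) hψb hHb hψlip hHlip'
  intro t u ht htu huc
  have h' := h t u ht htu huc
  have hu0 : u ≠ 0 := (ht.trans_le htu).ne'
  have ht0 : t ≠ 0 := ht.ne'
  simp only [mul_div_cancel_left₀ _ hu0, mul_div_cancel_left₀ _ ht0] at h'
  have e1 : (2 * (u * ∫ s in u..c, M s / s ^ 2) - M u - u * ∫ s in u..c, M s / s ^ 2) / u
      = ((u * ∫ s in u..c, M s / s ^ 2) - M u) / u := by ring
  have e2 : (2 * (t * ∫ s in t..c, M s / s ^ 2) - M t - t * ∫ s in t..c, M s / s ^ 2) / t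
      = ((t * ∫ s in t..c, M s / s ^ 2) - M t) / t := by ring
  rw [e1, e2] at h'
  refine h'.trans (le_of_eq ?_)
  ring

/-- **THE WINDOW MODULUS OF ψ′ = 2H′ − M′** with `L = 2(K_M + 10C_M) + L_M`. [folklore] -/
theorem psi1_windowModulus (hcont : ContinuousOn M (Ioo 0 δ)) (hc0 : 0 < c) (hcδ : c < δ)
    (hb : ∀ s ∈ Ioo 0 δ, |M s| ≤ CM) (hKM : 0 ≤ KM)
    (hlipM : ∀ t u : ℝ, 0 < t → t ≤ u → u < δ → |M u - M t| ≤ KM * Real.log (u / t))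
    (hmodM : ∀ t u : ℝ, 0 < t → t ≤ u → u < δ → |M₁ u - M₁ t| ≤ LM * (u - t) / t ^ 2) :
    ∀ t u : ℝ, 0 < t → t ≤ u → u < c →
      |(2 * (((u * ∫ s in u..c, M s / s ^ 2) - M u) / u) - M₁ u) - (2 * (((t * ∫ s in t..c, M s / s ^ 2) - M t) / t) - M₁ t)|
        ≤ (2 * (KM + 10 * CM) + LM) * (u - t) / t ^ 2 := by
  intro t u ht htu huc
  have h1 := Hderiv_windowModulus hcont hc0 hcδ hb hKM hlipM t u ht htu huc
  have h2 := hmodM t u ht htu (huc.trans hcδ)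
  calc _ = |2 * ((((u * ∫ s in u..c, M s / s ^ 2) - M u) / u) - (((t * ∫ s in t..c, M s / s ^ 2) - M t) / t)) - (M₁ u - M₁ t)| := by
        ring_nf
    _ ≤ |2 * ((((u * ∫ s in u..c, M s / s ^ 2) - M u) / u) - (((t * ∫ s in t..c, M s / s ^ 2) - M t) / t))| + |M₁ u - M₁ t| := abs_sub _ _
    _ ≤ 2 * ((KM + 10 * CM) * (u - t) / t ^ 2) + LM * (u - t) / t ^ 2 := by
        rw [abs_mul, abs_of_pos (by norm_num : (0:ℝ) < 2)]; linarith
    _ = (2 * (KM + 10 * CM) + LM) * (u - t) / t ^ 2 := by ring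

/-! ## §3 The harmonic two-thirds law -/

/-- **HEADLINE — THE HARMONIC TWO-THIRDS LAW.**  M with `M′ = M₁` on ]0, δ[, `|M| ≤ C_M`, K_M-log-Lipschitz (K_M ≥ 0), window modulus
`|M₁ u − M₁ t| ≤ L_M(u − t)∕t²` (L_M ≥ 0); `0 < c < δ`; `H(t) = t·∫ₜᶜ M s⁻²`; and the H-rate `|H t − m| ≤ A·t^γ` on ]0, τ] (A ≥ 0, 0 < γ ≤ 1).
Then for `0 < t ≤ min ((1∕2)^{3∕γ}) (min (τ∕2) (min (c∕2) 1))`: **`|M t − m| ≤ (5A + 4(2(K_M + 10C_M) + L_M))·t^{2γ∕3}`**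
(P2 #56f `twoThirds_law` on `Φ = tH`, `φ = ψ = 2H − M`; then `M − m = 2(H − m) − (ψ − m)` and `t^γ ≤ t^{2γ∕3}` for t ≤ 1). [folklore] -/
theorem harmonic_twoThirds_law (hM : ∀ t ∈ Ioo 0 δ, HasDerivAt M (M₁ t) t) (hc0 : 0 < c) (hcδ : c < δ)
    (hb : ∀ s ∈ Ioo 0 δ, |M s| ≤ CM) (hKM : 0 ≤ KM)
    (hlipM : ∀ t u : ℝ, 0 < t → t ≤ u → u < δ → |M u - M t| ≤ KM * Real.log (u / t)) (hLM : 0 ≤ LM)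
    (hmodM : ∀ t u : ℝ, 0 < t → t ≤ u → u < δ → |M₁ u - M₁ t| ≤ LM * (u - t) / t ^ 2)
    {τ A γ m : ℝ} (hA : 0 ≤ A) (hγ : 0 < γ) (hγ1 : γ ≤ 1)
    (hE : ∀ s ∈ Ioc 0 τ, |(s * ∫ σ in s..c, M σ / σ ^ 2) - m| ≤ A * s ^ γ) :
    ∀ t ∈ Ioc 0 (min ((1 / 2 : ℝ) ^ (3 / γ)) (min (τ / 2) (min (c / 2) 1))),
      |M t - m| ≤ (5 * A + 4 * (2 * (KM + 10 * CM) + LM)) * t ^ (2 * γ / 3) := by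
  have hcont : ContinuousOn M (Ioo 0 δ) := fun x hx => (hM x hx).continuousAt.continuousWithinAt
  have hCM : 0 ≤ CM := (abs_nonneg _).trans (hb (c / 2) ⟨by positivity, by linarith⟩)
  -- the two-thirds law on (Φ, ψ, ψ₁) with δ := c
  have hlaw := twoThirds_law (δ := c) (τ := τ) (Φ := fun t => t * (t * ∫ s in t..c, M s / s ^ 2))
    (φ := fun t => 2 * (t * ∫ s in t..c, M s / s ^ 2) - M t)
    (φ₁ := fun t => 2 * (((t * ∫ s in t..c, M s / s ^ 2) - M t) / t) - M₁ t) (L := 2 * (KM + 10 * CM) + LM) (A := A) (m := m)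
    (fun t ht => tH_hasDerivAt hcont hc0 hcδ ⟨ht.1, ht.2.trans hcδ⟩)
    (fun t ht => psi_hasDerivAt hM hc0 hcδ ⟨ht.1, ht.2.trans hcδ⟩) (by positivity)
    (psi1_windowModulus hcont hc0 hcδ hb hKM hlipM hmodM) hA hγ hγ1
    (fun s hs => by rw [mul_div_cancel_left₀ _ hs.1.ne']; exact hE s hs)
  intro t ht
  have ht0 : 0 < t := ht.1
  have htb : t ≤ (1 / 2 : ℝ) ^ (3 / γ) := ht.2.trans (min_le_left _ _)
  have htτ : t ≤ τ / 2 := ht.2.trans ((min_le_right _ _).trans (min_le_left _ _))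
  have htc : t ≤ c / 2 := ht.2.trans ((min_le_right _ _).trans ((min_le_right _ _).trans (min_le_left _ _)))
  have ht1 : t ≤ 1 := ht.2.trans ((min_le_right _ _).trans ((min_le_right _ _).trans (min_le_right _ _)))
  have hψ := hlaw t ⟨ht0, le_min htb (le_min htτ htc)⟩
  have hH := hE t ⟨ht0, by linarith⟩
  -- t^γ ≤ t^(2γ/3) for t ≤ 1
  have hpow : t ^ γ ≤ t ^ (2 * γ / 3) := Real.rpow_le_rpow_of_exponent_ge ht0 ht1 (by linarith)
  have hkey : M t - m = 2 * ((t * ∫ σ in t..c, M σ / σ ^ 2) - m) - ((2 * (t * ∫ s in t..c, M s / s ^ 2) - M t) - m) := by ring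
  rw [hkey]
  have hnn : 0 ≤ t ^ (2 * γ / 3) := Real.rpow_nonneg ht0.le _
  calc |2 * ((t * ∫ σ in t..c, M σ / σ ^ 2) - m) - ((2 * (t * ∫ s in t..c, M s / s ^ 2) - M t) - m)|
      ≤ |2 * ((t * ∫ σ in t..c, M σ / σ ^ 2) - m)| + |(2 * (t * ∫ s in t..c, M s / s ^ 2) - M t) - m| := abs_sub _ _
    _ ≤ 2 * (A * t ^ γ) + (3 * A + 4 * (2 * (KM + 10 * CM) + LM)) * t ^ (2 * γ / 3) := by
        rw [abs_mul, abs_of_pos (by norm_num : (0:ℝ) < 2)]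
        exact add_le_add (mul_le_mul_of_nonneg_left hH (by norm_num)) hψ
    _ ≤ 2 * (A * t ^ (2 * γ / 3)) + (3 * A + 4 * (2 * (KM + 10 * CM) + LM)) * t ^ (2 * γ / 3) := by
        have := mul_le_mul_of_nonneg_left hpow hA
        linarith
    _ = (5 * A + 4 * (2 * (KM + 10 * CM) + LM)) * t ^ (2 * γ / 3) := by ring

/-- **END — THE HARMONIC TWO-THIRDS LAW IN ROW L120's CLASS.**  φ interval-integrable on ]0, δ] with `|φ| ≤ C`, K-log-Lipschitz (K ≥ 0), with the
FTC `(∫₀φ)′ = φ` on ]0, δ[; M its Cesàro mean (bounded by C, 2C-log-Lipschitz, `M′ = (φ − M)∕t` with window modulus `K + 4C`, P2 #52a ∕ P2 #56f §2);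
`0 < c < δ`; H-rate `|t·∫ₜᶜ M s⁻² − m| ≤ A·t^γ` on ]0, τ] (0 < γ ≤ 1).  Then on the chart of the headline:
**`|M t − m| ≤ (5A + 4(2(2C + 10C) + (K + 4C)))·t^{2γ∕3}`** — against P2 #52f `harmonic_sqrt_law` (`4√(CE) + 3E`, exponent γ∕2, sharp for a
merely bounded φ): THE RG-TIME ∕ CUTOFF AVERAGE OF ROWS L127–L130 LOSES ONLY `γ ↦ 2γ∕3` IN ROW L120's CLASS. [folklore] -/
theorem harmonic_twoThirds_of_cesaro {φ : ℝ → ℝ} {C K : ℝ} (hδ : 0 < δ) (hint : ∀ t ∈ Ioc 0 δ, IntervalIntegrable φ volume 0 t)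
    (hbφ : ∀ v ∈ Ioc 0 δ, |φ v| ≤ C) (hK : 0 ≤ K)
    (hFTC : ∀ t ∈ Ioo 0 δ, HasDerivAt (fun s => ∫ v in (0:ℝ)..s, φ v) (φ t) t)
    (hlip : ∀ t u : ℝ, 0 < t → t ≤ u → u < δ → |φ u - φ t| ≤ K * Real.log (u / t))
    (hc0 : 0 < c) (hcδ : c < δ) {τ A γ m : ℝ} (hA : 0 ≤ A) (hγ : 0 < γ) (hγ1 : γ ≤ 1)
    (hE : ∀ s ∈ Ioc 0 τ, |(s * ∫ σ in s..c, ((∫ v in (0:ℝ)..σ, φ v) / σ) / σ ^ 2) - m| ≤ A * s ^ γ) :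
    ∀ t ∈ Ioc 0 (min ((1 / 2 : ℝ) ^ (3 / γ)) (min (τ / 2) (min (c / 2) 1))),
      |(∫ v in (0:ℝ)..t, φ v) / t - m| ≤ (5 * A + 4 * (2 * (2 * C + 10 * C) + (K + 4 * C))) * t ^ (2 * γ / 3) := by
  have hC := const_nonneg hδ hbφ
  -- M′ = (φ − M)/t and its window modulus (P2 #56f §2)
  have hM : ∀ t ∈ Ioo 0 δ, HasDerivAt (fun s => (∫ v in (0:ℝ)..s, φ v) / s) ((φ t - (∫ v in (0:ℝ)..t, φ v) / t) / t) t :=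
    fun t ht => quotient_hasDerivAt ht.1.ne' (hFTC t ht)
  have hmod := cesaro_deriv_windowModulus (Φ := fun s => ∫ v in (0:ℝ)..s, φ v) (KM := 2 * C) (CM := C) hK (by positivity)
    (fun t ht => hbφ t ⟨ht.1, ht.2.le⟩) (fun t ht => cesaro_abs_le hbφ ⟨ht.1, ht.2.le⟩) hlip (cesaro_logLip hint hbφ)
  have h := harmonic_twoThirds_law (M := fun s => (∫ v in (0:ℝ)..s, φ v) / s) (M₁ := fun t => (φ t - (∫ v in (0:ℝ)..t, φ v) / t) / t)
    (CM := C) (KM := 2 * C) (LM := K + 2 * C + C + C) hM hc0 hcδ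
    (fun s hs => cesaro_abs_le hbφ ⟨hs.1, hs.2.le⟩) (by positivity) (cesaro_logLip hint hbφ) (by positivity)
    (fun t u ht htu hu => hmod t u ht htu hu) hA hγ hγ1 hE
  intro t ht
  have := h t ht
  have e : K + 2 * C + C + C = K + 4 * C := by ring
  rwa [e] at this

end

end Summit.QuantumFields.BalabanUV.Beta.EriceFlowEnclosureHarmonicTwoThirdsLaw
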